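/-
COR-CM (cells pub-hodgecm / pub-hodgecm2, stage 2 of the Hodge ladder) — Δ2 BRIDGE, sublemma S1 AT THE PIN: THE S1 JUNCTION OF THE PIECES
PIN, DEFINITION-FREE (seat d2bridge-prove-1 g1).  The pieces pin `CorCM/D2Bridge/HcmPiecesAtTower.lean` (seat d2bridge-prove-8,
`nonempty_hcmPieces_ofTower`) consumes S1 as four binders — `dLiu : ℚ → LiuCMSide`, `u q : (A_μ ⊗ ℂ).X ⟶ (dLiu q).A.X`,
`hu : (f ≫ u q)^*_ℂ (dLiu q).α = (q : ℂ) • f^*_ℂ α₀`, `hadm : ∀ q, adm i (dLiu q)` — over the one-object rest (`D : ObjOne`, `A_μ := AμOne … D`)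
and the J-record's eigenclass `α₀ = M.α` in the currency of `CorCM/D2Bridge/HcmMLine.lean` (`lineModuleOne`: `M_μ = fieldOfValues L μ` acting
through `i_μ`).  THIS FILE supplies all four at once, as ONE ∃-theorem (`exists_dLiu_of_objOne`) proved from the S1 core
`exists_liuCMRecord_of_cmDatum` (`CorCM/D2Bridge/HcmS1LiuCMRecord.lean`: Liu's own `D_μ` of [Liu2021] Def. 4.5 (2) on its principal model,
CM type = THE INFLATED REFLEX TYPE) and R2 (`Transposition.isReflexOfType_of_reflexCMType`): `dLiu q := ⟨↥K*_μ, Ψ*_μ, M_μ, e_μ, B, ιB, θB, Ψ̃_μ, _,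
hB, (M_μ ⊆ ℂ), q • α', _⟩`, `u q := u`, admissibility for EVERY `Φ' = Φ_μ` (the pinned dictionary reads `adm` at `(line i).lineType = Φ_{μ_i}`),
for ANY `Algebra L ℂ` structure through `ι₁` (`hinst`).  Theorems only: no definition, no instance, no named fact; nothing landed is edited or
restated.  FRAMING: HC_CM is NOT proved; «Δ2 BRIDGE CLOSED» is NOT claimed; no pointer moves.
-/
import Summits.HodgeConjecture.CorCM.D2Bridge.HcmS1LiuCMRecord
import Summits.HodgeConjecture.CorCM.D2Bridge.HcmMLine
import Summits.HodgeConjecture.CorCM.B01.Transposition.Item6PinMatchReflexPairPkg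
import HarnessLib

set_option autoImplicit false

/-!
# Δ2 bridge, S1 at the pin: the junction `(dLiu, u, hu, hadm)` as one theorem

* `baseChange_hOneAlgHom_of_lineModuleOne` — currency: the J-record's eigen-law for `α₀` (`lineModuleOne`, `DistribSMul.toLinearMap` over
  `fieldOfValues L μ`) ⟹ the S1 core's `hα₀` (`hOneAlgHom` over `muAlgValueField L μ`);
* `exists_dLiu_of_objOne` — `∃ dLiu u, (∀ Φ', Φ_μ = Φ' → ∀ q, (dLiu q).IsReflexOfTypeG ι₁ Φ') ∧ ∀ q Y f, (f ≫ u q)^*_ℂ (dLiu q).α = (q : ℂ) • f^*_ℂ α₀`.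

References: Y. Liu, arXiv:2102.11518 = Camb. J. Math. 9 (2021), Def. 4.3 (2) (`FJcycle.tex` l. 1914–1921), Def. 4.5 (2) (l. 1944–1951), proof of
Thm. 4.18 (l. 2246–2253); G. Shimura, *Abelian Varieties with Complex Multiplication and Modular Functions* (1998) §7.1 Prop. 7, §8.3 Prop. 28;
D. Mumford, *Abelian Varieties* (1970) §19.  HC_CM is NOT proved.
-/

noncomputable section

open scoped TensorProduct

namespace Summit.HodgeConjecture.CorCM.D2Bridge

open CategoryTheory NumberField
open Literature.AlgebraicGeometry.Motives Literature.AlgebraicGeometry.HodgeTheory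
open Literature.AlgebraicGeometry.ComplexMultiplication
open Literature.NumberTheory.ComplexMultiplication Literature.NumberTheory.Automorphic
open Literature.NumberTheory.Automorphic.IdeleClassGroup Literature.NumberTheory.Automorphic.PicardCM
open Literature.NumberTheory.Automorphic.Liu2021 Literature.NumberTheory.Automorphic.Liu2021.AppendixC.RestOne
open HodgeCM.Model (LiuCMSide)

section Junction

variable {L : HodgeCM.CMField} [IsGalois ℚ L] (ι₁ : L →+* ℂ)
  {μ : Literature.NumberTheory.Automorphic.IdeleClassGroup L →ₜ* Circle} (hμ : IsConjugateSymplectic L μ)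
  (hw : HasWeight L μ 1) (Car : Def45.Carriers L μ)

/-- **Currency.**  At the one-object rest (`D : ObjOne`, `X := datum … D`, `A_μ ⊗ ℂ = AμC … D = (X.A).baseChange ℂ` along `ι₁`), an eigen-law for
`α₀` in the J-record's currency — `M_μ = fieldOfValues L μ` acting on `H¹_B(A_μ ⊗ ℂ; ℚ)` through `jOne D = (· ⊗ ℂ) ∘ i_μ ∘ ofFieldOfValues`
(`lineModuleOne`, `CorCM/D2Bridge/HcmMLine.lean`) — IS the S1 core's `hα₀` over the tree's `muAlgValueField L μ` and `hOneAlgHom ((· ⊗ ℂ) ∘ i_μ)`: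
the two value fields have the same elements (`mem_fieldOfValues_iff`) and both operators are `(i_{μ,ℂ} k)^*` (`hOneAlgHom_apply`, `rfl`).
[cite: Liu2021, §4.1 (FJcycle.tex l. 1926–1928) and proof of Thm. 4.18 (l. 2250)] -/
theorem baseChange_hOneAlgHom_of_lineModuleOne (D : ObjOne (AlgHom.id ℚ L) ι₁ hμ hw Car)
    (α₀ : ℂ ⊗[ℚ] bettiCohomology (letI := ι₁.toAlgebra; (AμC (AlgHom.id ℚ L) ι₁ hμ hw Car D).X) 1)
    (hα₀ : letI := ι₁.toAlgebra; letI := lineModuleOne (AlgHom.id ℚ L) ι₁ hμ hw Car D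
      ∀ s : fieldOfValues L μ,
        (DistribSMul.toLinearMap ℚ (bettiCohomology (AμC (AlgHom.id ℚ L) ι₁ hμ hw Car D).X 1) s).baseChange ℂ α₀ =
          algebraMap (fieldOfValues L μ) ℂ s • α₀)
    (k : muAlgValueField L μ) :
    letI := ι₁.toAlgebra
    haveI := hμ.numberField_muAlgValueField
    (hOneAlgHom ((AbelianVariety.endAlgebra.mapRingHom ((datum (AlgHom.id ℚ L) ι₁ hμ hw Car D).A.endBaseChange ℂ)).toRingHom.comp
        (datum (AlgHom.id ℚ L) ι₁ hμ hw Car D).i) k).baseChange ℂ α₀ = ((k : muAlgValueField L μ) : ℂ) • α₀ := by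
  letI := ι₁.toAlgebra
  haveI := hμ.numberField_muAlgValueField
  let s : fieldOfValues L μ := ⟨(k : ℂ), (mem_fieldOfValues_iff L μ (k : ℂ)).2 k.2⟩
  have e : (letI := lineModuleOne (AlgHom.id ℚ L) ι₁ hμ hw Car D
      DistribSMul.toLinearMap ℚ (bettiCohomology (AμC (AlgHom.id ℚ L) ι₁ hμ hw Car D).X 1) s) =
      hOneAlgHom ((AbelianVariety.endAlgebra.mapRingHom ((datum (AlgHom.id ℚ L) ι₁ hμ hw Car D).A.endBaseChange ℂ)).toRingHom.comp
        (datum (AlgHom.id ℚ L) ι₁ hμ hw Car D).i) k := by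
    apply LinearMap.ext
    intro x
    rw [hOneAlgHom_apply]
    rfl
  have h := hα₀ s
  rw [e] at h
  exact h

/-- **THE S1 JUNCTION OF THE PIECES PIN.**  For `L` Galois CM, the pin `ι₁` (any `Algebra L ℂ` through `ι₁`: `hinst`), a conjugate-symplectic
weight-one `μ`, the one object `D : ObjOne` of [Liu2021] Def. 4.5 (2) (`𝒜(μ) ≠ ∅`, Prop. 4.6 (1)) and a NON-ZERO eigenclass `α₀ ∈ ℂ ⊗ H¹_B(A_μ ⊗ ℂ; ℚ)`
for `M_μ ⊆ ℂ` in the J-record's currency (proof of Thm. 4.18, l. 2250): there are a `ℚ`-FAMILY OF MODEL CM RECORDS `dLiu q : LiuCMSide` — Liu's OWN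
datum on the principal model `B` of `A_μ ⊗_{L,ι₁} ℂ` (reflex data `(↥K*_μ, Ψ*_μ, M_μ, e_μ, M_μ ⊆ ℂ)`, CM type THE INFLATED REFLEX TYPE `Ψ̃_μ`,
class `q • α'`) — and ONE morphism `u : A_μ ⊗ ℂ ⟶ B` (an isogeny) with: (adm) `dLiu q` admissible in the package sense for EVERY `Φ' = Φ_μ`
(the pinned dictionary's `adm i` at `(line i).lineType = Φ_{μ_i}`), and (S4 law) `(f ≫ u)^*_ℂ (dLiu q).α = (q : ℂ) • f^*_ℂ α₀` for every
`ℂ`-morphism `f : Y ⟶ A_μ ⊗ ℂ`.  = the binders `dLiu ∕ u ∕ hu ∕ hadm` of `nonempty_hcmPieces_ofTower`.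
[cite: Liu2021, Def. 4.5 (2) (FJcycle.tex l. 1944–1951), Def. 4.3 (2) (l. 1919), Prop. 4.6 (1) (l. 1969), proof of Thm. 4.18 (l. 2246–2253)]
[cite: Shimura1998, §7.1 Proposition 7 (p. 47) and §8.3 Prop. 28] [cite: MumfordAV1970, §19 Remark p. 169] -/
theorem exists_dLiu_of_objOne [inst : Algebra (L : Type) ℂ] (hinst : ∀ x : L, algebraMap (L : Type) ℂ x = ι₁ x)
    (D : ObjOne (AlgHom.id ℚ L) ι₁ hμ hw Car)
    (α₀ : ℂ ⊗[ℚ] bettiCohomology (AμC (AlgHom.id ℚ L) ι₁ hμ hw Car D).X 1)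
    (hα₀ : letI := lineModuleOne (AlgHom.id ℚ L) ι₁ hμ hw Car D
      ∀ s : fieldOfValues L μ,
        (DistribSMul.toLinearMap ℚ (bettiCohomology (AμC (AlgHom.id ℚ L) ι₁ hμ hw Car D).X 1) s).baseChange ℂ α₀ =
          algebraMap (fieldOfValues L μ) ℂ s • α₀)
    (hα₀0 : α₀ ≠ 0) :
    ∃ (dLiu : ℚ → LiuCMSide) (u : ∀ q : ℚ, (AμC (AlgHom.id ℚ L) ι₁ hμ hw Car D).X ⟶ (dLiu q).A.X),
      (∀ Φ' : CMType L, hμ.cmType = Φ' → ∀ q : ℚ, (dLiu q).IsReflexOfTypeG ι₁ Φ') ∧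
      ∀ (q : ℚ) (Y : SchemeOver ℂ) (f : Y ⟶ (AμC (AlgHom.id ℚ L) ι₁ hμ hw Car D).X),
        (BettiUniverse.pull (f ≫ u q) 1).baseChange ℂ (dLiu q).α = (q : ℂ) • (BettiUniverse.pull f 1).baseChange ℂ α₀ := by
  obtain rfl : inst = ι₁.toAlgebra := Algebra.algebra_ext _ _ hinst
  haveI := hμ.numberField_muAlgValueField
  obtain ⟨B, u, ιB, θB, hB, α', -, hα', -, hlaw⟩ :=
    exists_liuCMRecord_of_cmDatum ι₁ (datum (AlgHom.id ℚ L) ι₁ hμ hw Car D) α₀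
      (baseChange_hOneAlgHom_of_lineModuleOne ι₁ hμ hw Car D α₀ hα₀) hα₀0
  refine ⟨fun q =>
    { K' := ↥(reflexField ℚ L (algValuedIn ι₁ hμ.cmType.1))
      Φ' := (reflexCMType ι₁ hμ.cmType (AlgHom.id ℚ L)).1
      M := ↥(muAlgValueField L μ)
      instNumberFieldM := hμ.numberField_muAlgValueField
      k := Def45.incl (AlgHom.id ℚ L) ι₁ hμ
      A := B, ιA := ιB, θA := θB
      ΦA := inducedCMType (Def45.incl (AlgHom.id ℚ L) ι₁ hμ) (reflexCMType ι₁ hμ.cmType (AlgHom.id ℚ L))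
      hΦA := fun θ => mem_inducedCMType_iff _ _ θ
      isRealisation := hB
      τ := (muAlgValueField L μ).subtype
      α := (q : ℂ) • α'
      α_mem := Submodule.smul_mem _ _ hα' }, fun _ => u.hom.hom.hom, ?_, fun q Y f => ?_⟩
  · rintro Φ' rfl q
    exact fun _ => Transposition.isReflexOfType_of_reflexCMType ι₁ hμ.cmType _ (RingEquiv.refl _)
      (RingHom.ext fun k => Def45.coe_incl (AlgHom.id ℚ L) ι₁ hμ k)
      (fun _ => Iff.of_eq (congrArg (fun χ => χ ∈ (reflexCMType ι₁ hμ.cmType (AlgHom.id ℚ L)).1) (RingHom.ext fun _ => rfl)))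
  · -- `(f ≫ u)^* (q • α') = q • (f ≫ u)^* α' = q • f^* α₀`
    refine (map_smul ((BettiUniverse.pull (f ≫ u.hom.hom.hom) 1).baseChange ℂ) (q : ℂ) α').trans ?_
    exact congrArg (fun x => (q : ℂ) • x) (hlaw Y f)

end Junction

end Summit.HodgeConjecture.CorCM.D2Bridge

end
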